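import Summits.QuantumAdvantage.QuantumAdvantage.Theses.SosSandwich

/-!
# Route `SosSandwich`: support item `AAConjImpliesPBAA` (stmt-QuantumAdvantage-15245)

Calibration: the Aaronson–Ambainis conjecture (inline form: every `[0,1]`-bounded polynomial of total
degree `≤ d` with `Var ≥ ε` has a variable of influence `≥ C (ε/d)^c`) implies PB-AA. A pseudo-bounded
`p` of order `T` (`p = Σ q_j²`, `1 - p = Σ r_j²` on the cube, `deg q_j, r_j ≤ T`) has the representative
`p' := Σ_j q_j²` of total degree `≤ 2T`, with values in `[0,1]` on the cube and the SAME cube values as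
`p` — hence the same variance and influences; AA at `d = 2T` gives `C (ε/(2T))^c = (C/2^c) (ε/T)^c`.
-/

set_option linter.dupNamespace false -- D-0017: single-problem summit ⇒ `QuantumAdvantage.QuantumAdvantage` by design

namespace Summit.QuantumAdvantage.QuantumAdvantage.Theorems.SosSandwich

open MvPolynomial Finset

/-- **`SosSandwich.AAConjImpliesPBAA`** (stmt-QuantumAdvantage-15245): the Aaronson–Ambainis conjecture for
bounded polynomials of degree `≤ d` implies its pseudo-bounded form PB-AA with the same exponent `c` and
constant `C / 2^c` — apply AA at `d = 2T` to the degree-`≤ 2T` representative `Σ_j q_j²`, which agrees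
with `p` on the cube. [cite: AaronsonAmbainis2014, Conj. 6 and Thm. 3.3] -/
theorem AAConjImpliesPBAA_proof :
    Summit.QuantumAdvantage.QuantumAdvantage.Theses.SosSandwich.AAConjImpliesPBAA := by
  unfold Summit.QuantumAdvantage.QuantumAdvantage.Theses.SosSandwich.AAConjImpliesPBAA
    Summit.QuantumAdvantage.QuantumAdvantage.Theses.SosSandwich.PseudoBoundedAA
  rintro ⟨c, C, hC, hAA⟩
  refine ⟨c, C / 2 ^ c, by positivity, ?_⟩
  intro N T p ε ev avg hT hPB hε hvar
  obtain ⟨m, q, r, hdeg, hval⟩ := hPB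
  -- the degree-≤ 2T representative
  set p' : MvPolynomial (Fin N) ℝ := ∑ j, q j ^ 2 with hp'
  have hev : ∀ x, ev p' x = ev p x := by
    intro x
    show MvPolynomial.eval _ p' = MvPolynomial.eval _ p
    rw [hp', map_sum]
    simp only [map_pow]
    exact ((hval x).1).symm
  have hfun : ev p' = ev p := funext hev
  have hdeg' : p'.totalDegree ≤ 2 * T := by
    rw [hp']
    refine (totalDegree_finsetSum _ _).trans (Finset.sup_le fun j _ => ?_)
    exact (totalDegree_pow _ _).trans (Nat.mul_le_mul_left 2 (hdeg j).1)
  have hbdd : ∀ x, 0 ≤ ev p' x ∧ ev p' x ≤ 1 := by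
    intro x
    rw [hev x]
    refine ⟨?_, ?_⟩
    · rw [(hval x).1]
      exact Finset.sum_nonneg fun j _ => sq_nonneg _
    · have h0 : 0 ≤ 1 - ev p x := by
        rw [(hval x).2]
        exact Finset.sum_nonneg fun j _ => sq_nonneg _
      linarith
  have hvar' : ε ≤ avg fun x => (ev p' x - avg (ev p')) ^ 2 := by
    rw [hfun]; exact hvar
  have h2T : 1 ≤ 2 * T := by omega
  obtain ⟨i, hi⟩ := hAA N (2 * T) p' ε h2T hdeg' hbdd hε hvar'
  refine ⟨i, ?_⟩
  have hi' : C * (ε / ((2 * T : ℕ) : ℝ)) ^ c ≤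
      avg fun x => (ev p' x - ev p' (Function.update x i (!x i))) ^ 2 := hi
  rw [hfun] at hi'
  have hcast : ((2 * T : ℕ) : ℝ) = 2 * (T : ℝ) := by push_cast; ring
  rw [hcast] at hi'
  calc C / 2 ^ c * (ε / (T : ℝ)) ^ c = C * (ε / (2 * (T : ℝ))) ^ c := by
          rw [div_pow, div_pow, mul_pow]; ring
    _ ≤ _ := hi'

end Summit.QuantumAdvantage.QuantumAdvantage.Theorems.SosSandwich
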